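import Mathlib
import HarnessLib
import Summits.Ventures.LatticeQCDFlow.Exactness.NCMCGeneralSpaceReversibleTauIntFloor
import Summits.Ventures.LatticeQCDFlow.Exactness.NCMCGeneralSpaceRestartChainEveryStart
import Summits.Ventures.LatticeQCDFlow.Exactness.GaugeFTHMCReversible

/-!
# Observables of the launch point along the restart chain ARE the level sampler's chain: `C_{G∘s}(t; R, P_F) = C_G(t; K, ν̄₀)` — so for a DETERMINISTIC protocol the Jarzynski lane's `σ²_w` is the level sampler's Green–Kubo variance, positive whenever `K` is reversible and minorised

HONEST FRAMING: exact (Metropolis-corrected) sampling algorithms for lattice gauge theory;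
figures of merit are autocorrelation/cost numbers at stated couplings and volumes; no
continuum-physics claim.

Venture `LatticeQCDFlow` (cell pub-lqcd), topic `Exactness`; FANOUT row 13 (`eng-snf`, GEN-22).
NEW WORK of the cell, not a published result; no definition is introduced; nothing is cited as a
fact.  `NCMCGeneralSpaceRestartChainVarianceFloor.lean` (GEN-22) discharges the hypothesis
`σ²_w > 0` of the Jarzynski lane's Γ-method coverage (`NCMCGeneralSpaceRestartChainGammaCoverage`)
for STOCHASTIC protocols (positive conditional work variance given the launch point); for a
DETERMINISTIC protocol — a pure flow / coupling-layer map, `W = w ∘ s` a function of the launch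
configuration — that floor is `0`.  This file treats the deterministic case: along the restart
chain `R = (κF ∘ₖ K).comap s` every observable of the form `G ∘ s` evolves exactly as `G` does along
the level sampler's own chain (`kop R (G ∘ s) = (kop K G) ∘ s`, a record remembers its start,
`CrooksPair.start_ae`), so its autocovariances under `P_F` are those of `G` under `ν̄₀ = Z₀⁻¹ν₀` and
its Green–Kubo variance is the level sampler's.  When `K` is REVERSIBLE for `ν₀` and minorised
(`m ≤ K(z, ·)`: HMC / Metropolis level samplers, rows 8/9), GEN-21's explicit floor for reversible
kernels (`tauInt_ge_of_isReversible_of_nHit`) makes that variance positive as soon as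
`Var_{ν̄₀} G > 0`.

## Content (Crooks pair, `Z₀ ≠ 0`; `K` Markov; `R = (κF ∘ₖ K).comap s`; `P_F = fwdPathLaw ν₀ κF`;
## `ν̄₀ = Z₀⁻¹ ν₀`; `G : Ω → ℝ` bounded measurable)

* **`CrooksPair.kop_restartKernel_comp_start`**, `…iterate…` — `(kop R)^[t] (G ∘ s) = ((kop K)^[t] G) ∘ s`.
* **`CrooksPair.integral_comp_start_fwdPathLaw`** — `∫ F ∘ s dP_F = ∫ F dν̄₀`;
  **`CrooksPair.autocov_restartKernel_comp_start`** — `autocov R P_F (G ∘ s) t = autocov K ν̄₀ G t`;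
  **`CrooksPair.greenKubo_variance_restartChain_comp_start_eq`** — the CLT variances agree (centred forms).
* **`CrooksPair.greenKubo_variance_restartChain_comp_start_pos_of_isReversible`** — `K` reversible
  for `ν₀`, `m ≤ K(z, ·)` ∀ `z` (`m(Ω) ≠ 0`), `Var_{ν̄₀} G > 0` ⇒ the Green–Kubo variance of `G ∘ s`
  along `R` is positive; **`…_exp_neg_work_pos_of_deterministic`** — the Jarzynski lane with a
  deterministic protocol `W = w ∘ s`: `σ²_w > 0` (the hypothesis `hσ` of
  `CrooksPair.tendsto_measure_jarzynskiEstimate_mem_gammaInterval_restartChain`).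

NOT CLAIMED: non-reversible level samplers with a deterministic protocol (GEN-21's counterexample
`NCMCGeneralSpaceAsymptoticVarianceCounterexample` shows a Doeblin power alone does not force
`σ² > 0`); anything numerical.
-/

namespace Summit.Ventures.LatticeQCDFlow.Exactness.GeneralNCMC

open MeasureTheory ProbabilityTheory Set Filter Finset
open scoped ENNReal Topology

variable {Ω E : Type*} [MeasurableSpace Ω] [MeasurableSpace E]

namespace CrooksPair

variable {ν₀ ν₁ : Measure Ω} [IsFiniteMeasure ν₀] [IsFiniteMeasure ν₁] {κF κR : Kernel Ω E}
  [IsMarkovKernel κF] [IsMarkovKernel κR] {s e : E → Ω} {W : E → ℝ}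

/-! ## §1 The restart kernel on observables of the start -/

omit [IsFiniteMeasure ν₀] [IsFiniteMeasure ν₁] [IsMarkovKernel κR] in
/-- **`kop R (G ∘ s) = (kop K G) ∘ s`**: along the restart kernel an observable of the launch point
moves as it does along the level sampler. -/
theorem kop_restartKernel_comp_start (K : Kernel Ω Ω) [IsMarkovKernel K]
    (h : CrooksPair ν₀ ν₁ κF κR s e W) {G : Ω → ℝ} (hG : Measurable G) {C : ℝ} (hC : ∀ x, |G x| ≤ C)
    (ω : E) :
    Scoring.kop ((κF ∘ₖ K).comap s h.measurable_s) (fun ω' => G (s ω')) ω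
      = Scoring.kop K G (s ω) := by
  simp only [Scoring.kop, Kernel.comap_apply]
  have hint : Integrable (fun ω' => G (s ω')) ((κF ∘ₖ K) (s ω)) :=
    Scoring.integrable_of_bounded _ (hG.comp h.measurable_s) (fun ω' => hC _)
  rw [Kernel.integral_comp hint]
  refine integral_congr_ae (Eventually.of_forall fun x => ?_)
  show ∫ ω', G (s ω') ∂(κF x) = G x
  rw [integral_congr_ae ((h.start_ae x).mono fun ω' hω' => by
    show G (s ω') = (fun _ => G x) ω'
    rw [hω']), integral_const, probReal_univ, one_smul]

omit [IsFiniteMeasure ν₀] [IsFiniteMeasure ν₁] [IsMarkovKernel κR] in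
/-- Iterated: `(kop R)^[t] (G ∘ s) = ((kop K)^[t] G) ∘ s`. -/
theorem iterate_kop_restartKernel_comp_start (K : Kernel Ω Ω) [IsMarkovKernel K]
    (h : CrooksPair ν₀ ν₁ κF κR s e W) {G : Ω → ℝ} (hG : Measurable G) {C : ℝ} (hC : ∀ x, |G x| ≤ C) :
    ∀ t : ℕ, (Scoring.kop ((κF ∘ₖ K).comap s h.measurable_s))^[t] (fun ω' => G (s ω'))
      = fun ω => (Scoring.kop K)^[t] G (s ω)
  | 0 => rfl
  | t + 1 => by
    obtain ⟨hm, hb⟩ := Scoring.iterate_kop_bounded_measurable K hG hC t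
    rw [Function.iterate_succ_apply', iterate_kop_restartKernel_comp_start K h hG hC t,
      Function.iterate_succ_apply']
    funext ω
    exact h.kop_restartKernel_comp_start K hm hb ω

/-! ## §2 Integrals and autocovariances of start observables under `P_F` -/

omit [IsFiniteMeasure ν₀] [IsFiniteMeasure ν₁] [IsMarkovKernel κR] in
/-- **`∫ F ∘ s dP_F = ∫ F d(Z₀⁻¹ν₀)`** for bounded measurable `F`. -/
theorem integral_comp_start_fwdPathLaw (h : CrooksPair ν₀ ν₁ κF κR s e W) {F : Ω → ℝ}
    (hF : Measurable F) {C : ℝ} (hC : ∀ x, |F x| ≤ C) :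
    ∫ ω, F (s ω) ∂(fwdPathLaw ν₀ κF) = ∫ x, F x ∂((ν₀ univ)⁻¹ • ν₀) := by
  rw [fwdPathLaw_eq_bind_smul]
  have hint : Integrable (fun ω => F (s ω)) (κF ∘ₘ ((ν₀ univ)⁻¹ • ν₀)) :=
    Scoring.integrable_of_bounded _ (hF.comp h.measurable_s) (fun ω => hC _)
  change ∫ ω, F (s ω) ∂(κF ∘ₘ ((ν₀ univ)⁻¹ • ν₀)) = _
  rw [Measure.comp_eq_comp_const_apply] at hint ⊢
  rw [Kernel.integral_comp hint, Kernel.const_apply]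
  refine integral_congr_ae (Eventually.of_forall fun x => ?_)
  show ∫ ω, F (s ω) ∂(κF x) = F x
  rw [integral_congr_ae ((h.start_ae x).mono fun ω' hω' => by
    show F (s ω') = (fun _ => F x) ω'
    rw [hω']), integral_const, probReal_univ, one_smul]

omit [IsFiniteMeasure ν₀] [IsFiniteMeasure ν₁] [IsMarkovKernel κR] in
/-- **The autocovariances of a start observable along the restart chain are the level sampler's**:
`autocov R P_F (G ∘ s) t = autocov K (Z₀⁻¹ν₀) G t`. -/
theorem autocov_restartKernel_comp_start (K : Kernel Ω Ω) [IsMarkovKernel K]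
    (h : CrooksPair ν₀ ν₁ κF κR s e W) {G : Ω → ℝ} (hG : Measurable G) {C : ℝ} (hC : ∀ x, |G x| ≤ C)
    (t : ℕ) :
    Scoring.autocov ((κF ∘ₖ K).comap s h.measurable_s) (fwdPathLaw ν₀ κF) (fun ω => G (s ω)) t
      = Scoring.autocov K ((ν₀ univ)⁻¹ • ν₀) G t := by
  obtain ⟨hm, hb⟩ := Scoring.iterate_kop_bounded_measurable K hG hC t
  have hC0 : ∀ x, 0 ≤ C := fun x => (abs_nonneg _).trans (hC x)
  unfold Scoring.autocov
  rw [h.iterate_kop_restartKernel_comp_start K hG hC t]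
  simp only
  exact h.integral_comp_start_fwdPathLaw (F := fun x => G x * (Scoring.kop K)^[t] G x) (hG.mul hm)
    (C := C * C) fun x => by
      rw [abs_mul]; exact mul_le_mul (hC x) (hb x) (abs_nonneg _) (hC0 x)

omit [IsFiniteMeasure ν₁] [IsMarkovKernel κR] in
/-- **The Green–Kubo variances agree**: with `θ = ∫ G ∘ s dP_F = ∫ G dν̄₀`,
`C_{(G−θ)∘s}(0) + 2 Σ' C_{(G−θ)∘s}(t+1)` along `R` equals `C_{G−θ}(0) + 2 Σ' C_{G−θ}(t+1)` along `K`. -/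
theorem greenKubo_variance_restartChain_comp_start_eq (K : Kernel Ω Ω) [IsMarkovKernel K]
    (h0 : ν₀ univ ≠ 0) (h : CrooksPair ν₀ ν₁ κF κR s e W) {G : Ω → ℝ} (hG : Measurable G) {C : ℝ}
    (hC : ∀ x, |G x| ≤ C) :
    Scoring.autocov ((κF ∘ₖ K).comap s h.measurable_s) (fwdPathLaw ν₀ κF)
          (fun ω => G (s ω) - ∫ z, G (s z) ∂(fwdPathLaw ν₀ κF)) 0
        + 2 * ∑' t, Scoring.autocov ((κF ∘ₖ K).comap s h.measurable_s) (fwdPathLaw ν₀ κF)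
          (fun ω => G (s ω) - ∫ z, G (s z) ∂(fwdPathLaw ν₀ κF)) (t + 1)
      = Scoring.autocov K ((ν₀ univ)⁻¹ • ν₀) (fun x => G x - ∫ z, G z ∂((ν₀ univ)⁻¹ • ν₀)) 0
        + 2 * ∑' t, Scoring.autocov K ((ν₀ univ)⁻¹ • ν₀)
          (fun x => G x - ∫ z, G z ∂((ν₀ univ)⁻¹ • ν₀)) (t + 1) := by
  haveI : IsProbabilityMeasure ((ν₀ univ)⁻¹ • ν₀) :=
    ⟨by rw [Measure.smul_apply, smul_eq_mul, ENNReal.inv_mul_cancel h0 (measure_ne_top _ _)]⟩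
  set θ := ∫ z, G z ∂((ν₀ univ)⁻¹ • ν₀) with hθ
  have hθ' : ∫ z, G (s z) ∂(fwdPathLaw ν₀ κF) = θ := h.integral_comp_start_fwdPathLaw hG hC
  rw [hθ']
  have hθb : |θ| ≤ C := by
    rw [hθ, ← Real.norm_eq_abs]
    calc ‖∫ z, G z ∂((ν₀ univ)⁻¹ • ν₀)‖ ≤ C * ((ν₀ univ)⁻¹ • ν₀).real univ :=
          norm_integral_le_of_norm_le_const (Eventually.of_forall fun z => by
            rw [Real.norm_eq_abs]; exact hC z)
      _ = C := by rw [probReal_univ, mul_one]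
  have hGm : Measurable fun x => G x - θ := hG.sub measurable_const
  have hGb : ∀ x, |G x - θ| ≤ C + C := fun x => (abs_sub _ _).trans (add_le_add (hC x) hθb)
  have key : ∀ t, Scoring.autocov ((κF ∘ₖ K).comap s h.measurable_s) (fwdPathLaw ν₀ κF)
      (fun ω => G (s ω) - θ) t = Scoring.autocov K ((ν₀ univ)⁻¹ • ν₀) (fun x => G x - θ) t :=
    fun t => h.autocov_restartKernel_comp_start K (G := fun x => G x - θ) hGm hGb t
  simp_rw [key]

/-! ## §3 Reversible, minorised level samplers: positivity for start observables -/

omit [IsFiniteMeasure ν₁] [IsMarkovKernel κR] in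
/-- **`σ² > 0` FOR START OBSERVABLES WHEN THE LEVEL SAMPLER IS REVERSIBLE AND MINORISED.**  Crooks pair
with `Z₀ ≠ 0`; `K` Markov, REVERSIBLE for `ν₀`, `m ≤ K(z, ·)` for all `z` (`m(Ω) ≠ 0`); `G` bounded
measurable with `Var_{Z₀⁻¹ν₀} G > 0`.  Then the Green–Kubo variance of `G ∘ s` along the restart chain
is positive. -/
theorem greenKubo_variance_restartChain_comp_start_pos_of_isReversible (K : Kernel Ω Ω)
    [IsMarkovKernel K] (h0 : ν₀ univ ≠ 0) (hrev : Kernel.IsReversible K ν₀)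
    (h : CrooksPair ν₀ ν₁ κF κR s e W) {m : Measure Ω} [IsFiniteMeasure m] (hm0 : m univ ≠ 0)
    (hmin : ∀ z, m ≤ K z) {G : Ω → ℝ} (hG : Measurable G) {C : ℝ} (hC : ∀ x, |G x| ≤ C)
    (hvar : 0 < ∫ x, (G x - ∫ z, G z ∂((ν₀ univ)⁻¹ • ν₀)) ^ 2 ∂((ν₀ univ)⁻¹ • ν₀)) :
    0 < Scoring.autocov ((κF ∘ₖ K).comap s h.measurable_s) (fwdPathLaw ν₀ κF)
          (fun ω => G (s ω) - ∫ z, G (s z) ∂(fwdPathLaw ν₀ κF)) 0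
        + 2 * ∑' t, Scoring.autocov ((κF ∘ₖ K).comap s h.measurable_s) (fwdPathLaw ν₀ κF)
          (fun ω => G (s ω) - ∫ z, G (s z) ∂(fwdPathLaw ν₀ κF)) (t + 1) := by
  rw [h.greenKubo_variance_restartChain_comp_start_eq K h0 hG hC]
  set nb := (ν₀ univ)⁻¹ • ν₀ with hnb
  haveI : IsProbabilityMeasure nb :=
    ⟨by rw [hnb, Measure.smul_apply, smul_eq_mul, ENNReal.inv_mul_cancel h0 (measure_ne_top _ _)]⟩
  have hrev' : Kernel.IsReversible K nb := isReversible_smul hrev _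
  -- `K` is minorised in one step by the normalised `m`
  haveI : IsProbabilityMeasure ((m univ)⁻¹ • m) :=
    ⟨by rw [Measure.smul_apply, smul_eq_mul, ENNReal.inv_mul_cancel hm0 (measure_ne_top _ _)]⟩
  have hminK : ∀ z, m univ • ((m univ)⁻¹ • m) ≤ nHit K 1 z := fun z => by
    rw [nHit_one, smul_smul, ENNReal.mul_inv_cancel hm0 (measure_ne_top _ _), one_smul]
    exact hmin z
  -- the reversible floor (GEN-21) with `J = 0`, `r = √(1 − e/2)`
  haveI : Nonempty Ω := nonempty_of_isProbabilityMeasure nb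
  have hε1 : m univ ≤ 1 := by
    haveI := isMarkovKernel_nHit K 1
    exact eps_le_one_of_minorised hminK
  have hεtop : m univ ≠ ∞ := ne_top_of_le_ne_top ENNReal.one_ne_top hε1
  have hepos : 0 < (m univ).toReal := ENNReal.toReal_pos hm0 hεtop
  have he1 : (m univ).toReal ≤ 1 := ENNReal.toReal_le_of_le_ofReal zero_le_one (by simpa using hε1)
  set r := Real.sqrt (1 - (m univ).toReal / 2) with hr
  have hbase : 0 < 1 - (m univ).toReal / 2 := by linarith
  have hr0 : 0 < r := Real.sqrt_pos.2 hbase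
  have hr1 : r < 1 := by
    rw [hr]
    calc Real.sqrt (1 - (m univ).toReal / 2) < Real.sqrt 1 :=
          Real.sqrt_lt_sqrt hbase.le (by linarith)
      _ = 1 := Real.sqrt_one
  have hrJ : 1 - (m univ).toReal / 2 ≤ r ^ (2 ^ (0 + 1)) := by
    rw [show (2 : ℕ) ^ (0 + 1) = 2 by norm_num, hr, Real.sq_sqrt hbase.le]
  have hfloor := (tauInt_ge_of_isReversible_of_nHit hrev' hm0 hminK Nat.one_pos (J := 0)
    (by norm_num) hr0 hr1 hrJ hG hC hvar).2
  -- `σ² = 2 a0 τ` with `a0 = Var > 0` and `τ ≥ (1 − r)/(2(1 + r)) > 0`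
  set a0 := Scoring.autocov K nb (fun x => G x - ∫ z, G z ∂nb) 0 with ha0def
  have ha0 : a0 = ∫ x, (G x - ∫ z, G z ∂nb) ^ 2 ∂nb := by
    rw [ha0def]; unfold Scoring.autocov; simp only [Function.iterate_zero, id_eq, sq]
  have ha0pos : 0 < a0 := by rw [ha0]; exact hvar
  have hτ : a0 + 2 * ∑' t, Scoring.autocov K nb (fun x => G x - ∫ z, G z ∂nb) (t + 1)
      = 2 * a0 * Scoring.tauInt
        (fun t => Scoring.autocov K nb (fun x => G x - ∫ z, G z ∂nb) t / a0) := by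
    have ha0ne : a0 ≠ 0 := ha0pos.ne'
    unfold Scoring.tauInt
    rw [tsum_div_const]
    field_simp
  rw [hτ]
  have hτpos : 0 < Scoring.tauInt (fun t => Scoring.autocov K nb (fun x => G x - ∫ z, G z ∂nb) t / a0) :=
    lt_of_lt_of_le (by have : 0 < 1 - r := by linarith
                       positivity) hfloor
  positivity

omit [IsFiniteMeasure ν₁] in
/-- **THE JARZYNSKI LANE WITH A DETERMINISTIC PROTOCOL AND A REVERSIBLE LEVEL SAMPLER: `σ²_w > 0`.**
Crooks pair with `Z₀ ≠ 0`, `e^{−ΔF} = Z₁/Z₀`; the work a function of the launch configuration,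
`W = w ∘ s` with `w` measurable and `−B ≤ w`; `K` Markov, reversible for `ν₀`, `m ≤ K(z, ·)` ∀ `z`
(`m(Ω) ≠ 0`); the weight not `ν̄₀`-a.s. constant (`Var_{ν̄₀} e^{−w} > 0`).  Then the Green–Kubo variance
of the weights along the restart chain — the hypothesis `hσ` of
`CrooksPair.tendsto_measure_jarzynskiEstimate_mem_gammaInterval_restartChain` — is positive. -/
theorem greenKubo_variance_exp_neg_work_pos_of_deterministic (K : Kernel Ω Ω) [IsMarkovKernel K]
    (h0 : ν₀ univ ≠ 0) (hrev : Kernel.IsReversible K ν₀) (h : CrooksPair ν₀ ν₁ κF κR s e W)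
    {m : Measure Ω} [IsFiniteMeasure m] (hm0 : m univ ≠ 0) (hmin : ∀ z, m ≤ K z)
    {w : Ω → ℝ} (hw : Measurable w) (hW : ∀ ω, W ω = w (s ω)) {B : ℝ} (hB : ∀ x, -B ≤ w x)
    (hvar : 0 < ∫ x, (Real.exp (-w x) - ∫ z, Real.exp (-w z) ∂((ν₀ univ)⁻¹ • ν₀)) ^ 2
      ∂((ν₀ univ)⁻¹ • ν₀)) :
    0 < Scoring.autocov ((κF ∘ₖ K).comap s h.measurable_s) (fwdPathLaw ν₀ κF)
          (fun ω => Real.exp (-W ω) - ((ν₀ univ)⁻¹ * ν₁ univ).toReal) 0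
        + 2 * ∑' t, Scoring.autocov ((κF ∘ₖ K).comap s h.measurable_s) (fwdPathLaw ν₀ κF)
          (fun ω => Real.exp (-W ω) - ((ν₀ univ)⁻¹ * ν₁ univ).toReal) (t + 1) := by
  have hC : ∀ x, |Real.exp (-w x)| ≤ Real.exp B := fun x => by
    rw [abs_of_pos (Real.exp_pos _)]
    exact Real.exp_le_exp.2 (by linarith [hB x])
  have key := h.greenKubo_variance_restartChain_comp_start_pos_of_isReversible K h0 hrev hm0 hmin
    (G := fun x => Real.exp (-w x)) (Real.measurable_exp.comp hw.neg) hC hvar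
  have hθ : ∫ z, Real.exp (-w (s z)) ∂(fwdPathLaw ν₀ κF) = ((ν₀ univ)⁻¹ * ν₁ univ).toReal := by
    rw [← h.integral_exp_neg_work]
    exact integral_congr_ae (Eventually.of_forall fun z => by
      show Real.exp (-w (s z)) = Real.exp (-W z)
      rw [hW z])
  rw [hθ] at key
  simp only [hW]
  exact key

end CrooksPair

end Summit.Ventures.LatticeQCDFlow.Exactness.GeneralNCMC
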